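import Summits.Ventures.YMGap.Thresholds.StarLimitStatesSUN
import Summits.Ventures.YMGap.Thresholds.StarLimitPlaquette
import HarnessLib

/-!
# Venture YMGap — track (c) «DS»: every infinite-volume limit state of `SU(N)` lattice Yang–Mills (`d = 4`,
# Wilson, EVERY `N ≥ 2`) is MASSIVE at every tree coupling `|β|/N ≤ 9/308`, and its plaquette–plaquette
# correlation function decays exponentially — hypothesis-free, two-sided

HONEST FRAMING: venture file (cell `pub-ymgap`, PLAN R128(b)(ii); ds-3), strong-coupling LATTICE statements only,
for `SU(N)` lattice Yang–Mills on `ℤ⁴` with the Wilson plaquette weight `exp(−β (N − Re tr U_q))` at tree coupling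
`β` ('t Hooft `β/N`).  The statements quantify over infinite-volume LIMIT STATES (`infiniteVolumeLimitPoints`:
subsequential weak limits of the torus Wilson states; non-empty by compactness).  Currencies:
`Literature.Barriers.QuantumFields.IsMassiveState μ` (exponential clustering at ONE rate of all truncated
correlations of bounded measurable local observables — clause (iii) of the tree's `osterwalder_seiler_strongCoupling`)
and `HasExponentialDecay (plaquetteCorrFn (fundamentalRep (Fin N)) μ)` (Chatterjee's `f_β`; the operational
mass-gap criterion of Montvay–Münster §3.4.5).  Nothing about uniqueness of the DLR state (ds-1's rows in
`StarSUNRows.lean`), the `MassGapAt`/`ImprovedThreshold` currency (ds-1's `StarMassGapSUN`), the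
continuum, confinement or a transfer-matrix gap; no `d ≠ 4`; the rate is `κ(ρ) = (1−ρ)²/(2(16ρ+1))`, tiny near
the door.

WHAT IS NEW HERE is only the port `Fin 2 ↦ Fin N` of ds-2's `SU(2)`-typed `StarLimit.su2Star_limitState_covariance_decay`
/ `su2Star_isMassiveState` (`StarLimitStates.lean`) and `hasExponentialDecay_plaquetteCorrFn_of_isMassiveState` /
`su2Star_hasExponentialDecay_plaquetteCorrFn` (`StarLimitPlaquette.lean`), with the `SU(2)`-typed hypothesis
`StarWindowBound` replaced by the four window clauses, and the instantiation by tree theorems: the generic-`N`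
star window `StarLemmaGSUN.star_window_of_oneLinkKRModulus` (ds-1; port of ds-4's Lemma G capstone), the
Bakry–Émery one-link modulus `oneLinkKRModulus_SU` (`K = 1/(1/2 − R)`, Shen–Zhu–Zhu Lemma 4.1; coefficient arithmetic as in ds-1's
`StarSUN.bakryEmery_coef_le_abs`), and the tree's plaquette criterion
`Literature.Barriers.QuantumFields.not_exists_clusteringRate_of_not_hasExponentialDecay_plaquetteCorrFn`.
The `SU(3)` rows in Wilson units and the rows for DLR states are in `StarMassiveSUNRows.lean`.

* `star_limitState_covariance_decay`, `star_isMassiveState`, `star_hasExponentialDecay_plaquetteCorrFn` — the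
  four-clause schema on all tori of side `≥ L₁`, one `ρ < 1`;
* `isMassiveState_of_oneLinkKRModulus`, `hasExponentialDecay_plaquetteCorrFn_of_oneLinkKRModulus` — from ANY
  one-link modulus `OneLinkKRModulus N R K`, `K ≥ 0`, `R ≥ 6|β|/N`, `4K|β|/N ≤ 9/25` (rate `κ(R_G(4K|β|/N))`);
* ★ `isMassiveState_SU_star (hN : 2 ≤ N) (h : |β|/N ≤ 9/308)` and
  ★ `hasExponentialDecay_plaquetteCorrFn_SU_star (hN : 2 ≤ N) (h : |β|/N ≤ 9/308)` — EVERY `N ≥ 2`,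
  HYPOTHESIS-FREE, TWO-SIDED (the chain only ever sees `|β|`).

Comparison: `SU(2)` has the sharper hypothesis-free rows `su2_isMassiveState_le_9_25` /
`su2_hasExponentialDecay_plaquetteCorrFn_le_9_25` (`StarLimitMassive.lean`, ds-2: quarter modulus, Wilson
`β_W ≤ 9/25`, i.e. 't Hooft `9/100`); here every `N ≥ 2` at 't Hooft `|β|/N ≤ 9/308 = 0.02922…` (printed
Osterwalder–Seiler / Shen–Zhu–Zhu strong-coupling bar in this currency: `1/48 = 0.02083…`).

References: K. Osterwalder, E. Seiler, Ann. Phys. 110 (1978) §4; H. Shen, R. Zhu, X. Zhu, CMP 400 (2023)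
Lemma 4.1; I. Montvay, G. Münster (1994) §3.4.5, §3.7; H. Föllmer, LNM 1362 (1988) Ch. I Thm. (2.13);
cell files `LIMIT-STATES.md` (ds-2), `STAR-SUN-SIGNATURES.md` (ds-1).
-/

noncomputable section

open MeasureTheory ProbabilityTheory Function Finset Filter Topology
open Literature.Probability.LatticeModels
open Literature.Probability.LatticeModels.DobrushinMetric
open Literature.MathematicalPhysics.QuantumLattice (IsCylinder LGConfig fundamentalRep
  infiniteVolumeLimitPoints IsInfiniteVolumeLimitAlong plaquetteCorrFn continuous_fundamentalRep
  fundamentalRep_mem_unitaryGroup)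
open Literature.MathematicalPhysics.QuantumFieldTheory
open Literature.MathematicalPhysics.QuantumFieldTheory.Balaban1983to89
open Literature.MathematicalPhysics.QuantumFieldTheory.Balaban1983to89.StrongCouplingTorusWindow
open Literature.MathematicalPhysics.QuantumFieldTheory.Balaban1983to89.StrongCouplingDobrushinWindow
  (OneLinkKRModulus)
open Literature.MathematicalPhysics.QuantumFieldTheory.Balaban1983to89.StrongCouplingKernelWindow
  (oneLinkKRModulus_SU)
open Literature.Barriers.QuantumFields (IsMassiveState)
open Summit.Ventures.YMGap.DSWindow
open Summit.Ventures.YMGap.StarWindowGauge (gaugeR gaugeR_lt_one_of_le)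
open Summit.Ventures.YMGap.StarLemmaGSUN (star_window_of_oneLinkKRModulus)

namespace Summit.Ventures.YMGap.StarSUNMassive

variable {N : ℕ}

/-! ### The schema: exponential clustering of every limit state from star windows on all large tori -/

/-- **Exponential clustering of every infinite-volume limit state from star windows on all large tori**
(`SU(N)`, `d = 4`, tree coupling `β`): if every torus of side `L ≥ L₁` carries a star-window influence array
(four clauses) with ONE received sum `ρ < 1`, then for all bounded measurable local observables `F₁, F₂` of
`ℤ⁴` there is ONE constant `C` such that for EVERY limit state `μ ∈ infiniteVolumeLimitPoints (fundamentalRep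
(Fin N)) β` and every displacement `x ∈ ℤ⁴`, `|cov_μ(F₁, F₂ ∘ θ_x)| ≤ C e^{−κ(ρ) ‖x‖_∞}`.  Port of
`StarLimit.su2Star_limitState_covariance_decay` (near/far split; far = `star_limitState_cov_far`). [folklore] -/
theorem star_limitState_covariance_decay (hN : 1 ≤ N) (β : ℝ) {ρ : ℝ} (hρ0 : 0 ≤ ρ) (hρ1 : ρ < 1)
    (L₁ : ℕ)
    (hW : ∀ (L : ℕ) [NeZero L], L₁ ≤ L → ∃ Kw : Site 4 L → Edge 4 L → Edge 4 L → ℝ,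
      (∀ s y e, 0 ≤ Kw s y e) ∧ (∀ s y e, Kw s y e ≠ 0 → ∀ w ∈ linkEnds y, torusNorm (s - w) ≤ 1) ∧
      IsLinkWindowContraction (d := 4) (L := L) (wilsonPlaqWeight N β) suFrobDist starWin
        (fun c => Kw c.1) ∧
      ∀ (s : Site 4 L) (e : Edge 4 L), e ∈ vertexStar s → ∑ y, Kw s y e ≤ ρ)
    (F₁ F₂ : LGConfig 4 (Matrix.specialUnitaryGroup (Fin N) ℂ) → ℝ)
    (h₁ : Literature.MathematicalPhysics.QuantumLattice.IsLocalObservable F₁)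
    (h₂ : Literature.MathematicalPhysics.QuantumLattice.IsLocalObservable F₂) (h₁m : Measurable F₁)
    (h₂m : Measurable F₂) (hb₁ : ∃ C, ∀ U, |F₁ U| ≤ C) (hb₂ : ∃ C, ∀ U, |F₂ U| ≤ C) :
    ∃ C : ℝ, ∀ μ ∈ infiniteVolumeLimitPoints (d := 4) (fundamentalRep (Fin N)) β,
      ∀ x : Literature.Probability.LatticeModels.Site 4,
        |cov[F₁, fun U => F₂ (Literature.MathematicalPhysics.QuantumLattice.configShift x U); μ]| ≤
          C * Real.exp (-starRate ρ * ‖x‖) := by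
  classical
  obtain ⟨S₁, hS₁⟩ := h₁
  obtain ⟨S₂, hS₂⟩ := h₂
  obtain ⟨M₁, hM₁⟩ := hb₁
  obtain ⟨M₂, hM₂⟩ := hb₂
  have hκ0 : 0 < starRate ρ := starRate_pos hρ0 hρ1
  have hM₁0 : 0 ≤ M₁ := (abs_nonneg _).trans (hM₁ fun _ => 1)
  have hM₂0 : 0 ≤ M₂ := (abs_nonneg _).trans (hM₂ fun _ => 1)
  have hE0 : 0 ≤ wilsonSmoothLip N 4 β := wilsonSmoothLip_nonneg hN 4 β
  have hJ0 : (0 : ℝ) ≤ (((1 + 4 * (2 * (4 - 1)) : ℕ) : ℝ)) := Nat.cast_nonneg _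
  -- the diameter of the two supports, the constant
  have hD : ∀ a₀ ∈ S₁, ∀ b₀ ∈ S₂, Literature.Probability.LatticeModels.Site.supNorm (a₀.1 - b₀.1) ≤
      (S₁ ×ˢ S₂).sup fun ab => Literature.Probability.LatticeModels.Site.supNorm (ab.1.1 - ab.2.1) :=
    fun a₀ ha₀ b₀ hb₀ => Finset.le_sup
      (f := fun ab : Literature.MathematicalPhysics.QuantumLattice.ZdEdge 4 ×
          Literature.MathematicalPhysics.QuantumLattice.ZdEdge 4 =>
        Literature.Probability.LatticeModels.Site.supNorm (ab.1.1 - ab.2.1))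
      (Finset.mk_mem_product ha₀ hb₀)
  generalize ((S₁ ×ˢ S₂).sup fun ab =>
    Literature.Probability.LatticeModels.Site.supNorm (ab.1.1 - ab.2.1)) = D at hD
  set K' : ℝ := Real.exp (starRate ρ * ((D + 6 : ℕ) : ℝ)) with hK'def
  have hK'0 : 0 < K' := Real.exp_pos _
  set A : ℝ := 4 * (2 * Real.sqrt N) ^ 2 *
      (((((1 + 4 * (2 * (4 - 1))) * S₁.card : ℕ) : ℝ)) * (((1 + 4 * (2 * (4 - 1)) : ℕ) : ℝ)) *
        (M₁ * wilsonSmoothLip N 4 β)) *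
      (((((1 + 4 * (2 * (4 - 1))) * S₂.card : ℕ) : ℝ)) * (((1 + 4 * (2 * (4 - 1)) : ℕ) : ℝ)) *
        (M₂ * wilsonSmoothLip N 4 β)) with hAdef
  have hA0 : 0 ≤ A := by positivity
  refine ⟨2 * M₁ * M₂ * K' + A * K', fun μ hμ x => ?_⟩
  obtain ⟨Lseq, hLmono, hμL⟩ := hμ
  haveI := hμL.1
  have hGxm : Measurable (F₂ ∘ Literature.MathematicalPhysics.QuantumLattice.configShift x) :=
    h₂m.comp (Literature.MathematicalPhysics.QuantumLattice.configShift x).measurable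
  have hGxM : ∀ U, |(F₂ ∘ Literature.MathematicalPhysics.QuantumLattice.configShift x) U| ≤ M₂ :=
    fun U => hM₂ _
  have hcov : cov[F₁, fun U => F₂ (Literature.MathematicalPhysics.QuantumLattice.configShift x U); μ] =
      (∫ U, F₁ U * (F₂ ∘ Literature.MathematicalPhysics.QuantumLattice.configShift x) U ∂μ) -
        (∫ U, F₁ U ∂μ) *
          ∫ U, (F₂ ∘ Literature.MathematicalPhysics.QuantumLattice.configShift x) U ∂μ := by
    have l₁ : MemLp F₁ 2 μ := memLp_of_bounded (a := -M₁) (b := M₁)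
      (ae_of_all _ fun U => abs_le.1 (hM₁ U)) h₁m.aestronglyMeasurable 2
    have l₂ : MemLp (F₂ ∘ Literature.MathematicalPhysics.QuantumLattice.configShift x) 2 μ :=
      memLp_of_bounded (a := -M₂) (b := M₂) (ae_of_all _ fun U => abs_le.1 (hGxM U))
        hGxm.aestronglyMeasurable 2
    exact covariance_eq_sub l₁ l₂
  rw [Literature.Probability.LatticeModels.Site.norm_eq_supNorm x, hcov]
  have hexp0 : 0 < Real.exp (-starRate ρ * (Literature.Probability.LatticeModels.Site.supNorm x : ℕ)) :=
    Real.exp_pos _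
  by_cases hnear : Literature.Probability.LatticeModels.Site.supNorm x < D + 6
  · -- NEAR: the trivial bound `|cov| ≤ 2 M₁ M₂` and `K' e^{-κ ‖x‖} ≥ 1`
    have htriv : |(∫ U, F₁ U * (F₂ ∘ Literature.MathematicalPhysics.QuantumLattice.configShift x) U ∂μ) -
        (∫ U, F₁ U ∂μ) *
          ∫ U, (F₂ ∘ Literature.MathematicalPhysics.QuantumLattice.configShift x) U ∂μ| ≤
        2 * M₁ * M₂ := by
      refine (abs_sub _ _).trans ?_
      have h1 := abs_integral_le_of_abs_le (μ := μ) (abs_mul_le_of_abs_le hM₁ hGxM)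
      have h2 : |(∫ U, F₁ U ∂μ) *
          ∫ U, (F₂ ∘ Literature.MathematicalPhysics.QuantumLattice.configShift x) U ∂μ| ≤ M₁ * M₂ := by
        rw [abs_mul]
        exact mul_le_mul (abs_integral_le_of_abs_le hM₁) (abs_integral_le_of_abs_le hGxM)
          (abs_nonneg _) hM₁0
      linarith
    have hone : 1 ≤ K' *
        Real.exp (-starRate ρ * (Literature.Probability.LatticeModels.Site.supNorm x : ℕ)) := by
      rw [hK'def, ← Real.exp_add]
      refine Real.one_le_exp ?_
      have : ((Literature.Probability.LatticeModels.Site.supNorm x : ℕ) : ℝ) ≤ ((D + 6 : ℕ) : ℝ) := by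
        exact_mod_cast hnear.le
      nlinarith
    refine htriv.trans ?_
    have h2MM : 0 ≤ 2 * M₁ * M₂ := by positivity
    calc 2 * M₁ * M₂ ≤ 2 * M₁ * M₂ * (K' *
          Real.exp (-starRate ρ * (Literature.Probability.LatticeModels.Site.supNorm x : ℕ))) :=
          le_mul_of_one_le_right h2MM hone
      _ = 2 * M₁ * M₂ * K' *
          Real.exp (-starRate ρ * (Literature.Probability.LatticeModels.Site.supNorm x : ℕ)) := by
          ring
      _ ≤ (2 * M₁ * M₂ * K' + A * K') *
          Real.exp (-starRate ρ * (Literature.Probability.LatticeModels.Site.supNorm x : ℕ)) := by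
          rw [add_mul]
          exact le_add_of_nonneg_right (mul_nonneg (mul_nonneg hA0 hK'0.le) hexp0.le)
  -- FAR: `D + 6 ≤ ‖x‖_∞`
  rw [not_lt] at hnear
  have hle := star_limitState_cov_far hN β hρ0 hρ1 L₁ hW hLmono hμL h₁m h₂m hS₁ hS₂ hM₁ hM₂ x hD hnear
  refine hle.trans ?_
  have hexp : Real.exp (-(starRate ρ *
      ((Literature.Probability.LatticeModels.Site.supNorm x - (D + 2 + 4) : ℕ) : ℝ))) ≤
      K' * Real.exp (-starRate ρ * (Literature.Probability.LatticeModels.Site.supNorm x : ℕ)) := by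
    rw [hK'def, ← Real.exp_add]
    refine Real.exp_le_exp.2 ?_
    have : ((Literature.Probability.LatticeModels.Site.supNorm x - (D + 2 + 4) : ℕ) : ℝ) =
        (Literature.Probability.LatticeModels.Site.supNorm x : ℝ) - ((D + 6 : ℕ) : ℝ) := by
      rw [show D + 2 + 4 = D + 6 by ring, Nat.cast_sub hnear]
    rw [this]
    nlinarith
  have hB0 : 0 ≤ (((((1 + 4 * (2 * (4 - 1))) * S₁.card : ℕ) : ℝ)) * (((1 + 4 * (2 * (4 - 1)) : ℕ) : ℝ)) *
      (M₁ * wilsonSmoothLip N 4 β)) := by positivity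
  have hC0 : 0 ≤ (((((1 + 4 * (2 * (4 - 1))) * S₂.card : ℕ) : ℝ)) * (((1 + 4 * (2 * (4 - 1)) : ℕ) : ℝ)) *
      (M₂ * wilsonSmoothLip N 4 β)) := by positivity
  have h4 : (0 : ℝ) ≤ 4 * (2 * Real.sqrt N) ^ 2 := by positivity
  calc 4 * (2 * Real.sqrt N) ^ 2 *
        Real.exp (-(starRate ρ *
          ((Literature.Probability.LatticeModels.Site.supNorm x - (D + 2 + 4) : ℕ) : ℝ))) *
        (((((1 + 4 * (2 * (4 - 1))) * S₁.card : ℕ) : ℝ)) * (((1 + 4 * (2 * (4 - 1)) : ℕ) : ℝ)) *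
          (M₁ * wilsonSmoothLip N 4 β)) *
        (((((1 + 4 * (2 * (4 - 1))) * S₂.card : ℕ) : ℝ)) * (((1 + 4 * (2 * (4 - 1)) : ℕ) : ℝ)) *
          (M₂ * wilsonSmoothLip N 4 β))
      ≤ 4 * (2 * Real.sqrt N) ^ 2 * (K' *
          Real.exp (-starRate ρ * (Literature.Probability.LatticeModels.Site.supNorm x : ℕ))) *
        (((((1 + 4 * (2 * (4 - 1))) * S₁.card : ℕ) : ℝ)) * (((1 + 4 * (2 * (4 - 1)) : ℕ) : ℝ)) *
          (M₁ * wilsonSmoothLip N 4 β)) *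
        (((((1 + 4 * (2 * (4 - 1))) * S₂.card : ℕ) : ℝ)) * (((1 + 4 * (2 * (4 - 1)) : ℕ) : ℝ)) *
          (M₂ * wilsonSmoothLip N 4 β)) :=
        mul_le_mul_of_nonneg_right (mul_le_mul_of_nonneg_right
          (mul_le_mul_of_nonneg_left hexp h4) hB0) hC0
    _ = A * K' * Real.exp (-starRate ρ * (Literature.Probability.LatticeModels.Site.supNorm x : ℕ)) := by
        rw [hAdef]; ring
    _ ≤ (2 * M₁ * M₂ * K' + A * K') *
          Real.exp (-starRate ρ * (Literature.Probability.LatticeModels.Site.supNorm x : ℕ)) := by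
        rw [add_mul]
        exact le_add_of_nonneg_left (by positivity)

/-- **Every infinite-volume limit state is massive, from star windows on all large tori** (`SU(N)`, `d = 4`):
every `μ ∈ infiniteVolumeLimitPoints (fundamentalRep (Fin N)) β` is a massive state
(`Literature.Barriers.QuantumFields.IsMassiveState`, one rate `κ(ρ)`; the gauge-invariance clauses of that
predicate are not needed).  Port of `StarLimit.su2Star_isMassiveState`. [folklore] -/
theorem star_isMassiveState (hN : 1 ≤ N) (β : ℝ) {ρ : ℝ} (hρ0 : 0 ≤ ρ) (hρ1 : ρ < 1) (L₁ : ℕ)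
    (hW : ∀ (L : ℕ) [NeZero L], L₁ ≤ L → ∃ Kw : Site 4 L → Edge 4 L → Edge 4 L → ℝ,
      (∀ s y e, 0 ≤ Kw s y e) ∧ (∀ s y e, Kw s y e ≠ 0 → ∀ w ∈ linkEnds y, torusNorm (s - w) ≤ 1) ∧
      IsLinkWindowContraction (d := 4) (L := L) (wilsonPlaqWeight N β) suFrobDist starWin
        (fun c => Kw c.1) ∧
      ∀ (s : Site 4 L) (e : Edge 4 L), e ∈ vertexStar s → ∑ y, Kw s y e ≤ ρ) :
    ∀ μ ∈ infiniteVolumeLimitPoints (d := 4) (fundamentalRep (Fin N)) β, IsMassiveState μ := by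
  intro μ hμ
  refine ⟨starRate ρ, fun F₁ F₂ h₁ h₂ h₁m h₂m hb₁ hb₂ _ _ => ?_⟩
  obtain ⟨C, hC⟩ := star_limitState_covariance_decay hN β hρ0 hρ1 L₁ hW F₁ F₂ h₁ h₂ h₁m h₂m hb₁ hb₂
  exact ⟨starRate_pos hρ0 hρ1, C, fun x => hC μ hμ x⟩

/-- A massive infinite-volume limit state of `SU(N)` lattice Yang–Mills (`d = 4`) has an exponentially
decaying plaquette–plaquette correlation function (contrapositive of the tree's plaquette criterion
`not_exists_clusteringRate_of_not_hasExponentialDecay_plaquetteCorrFn`, whose conclusion is literally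
`¬ IsMassiveState μ`).  Port of `StarLimit.hasExponentialDecay_plaquetteCorrFn_of_isMassiveState`. [folklore] -/
theorem hasExponentialDecay_plaquetteCorrFn_of_isMassiveState {β : ℝ}
    {μ : Measure (LGConfig 4 (Matrix.specialUnitaryGroup (Fin N) ℂ))}
    (hμ : μ ∈ infiniteVolumeLimitPoints (d := 4) (fundamentalRep (Fin N)) β) (hm : IsMassiveState μ) :
    HasExponentialDecay (plaquetteCorrFn (fundamentalRep (Fin N)) μ) := by
  haveI : SecondCountableTopology (Matrix (Fin N) (Fin N) ℂ) :=
    inferInstanceAs (SecondCountableTopology (Fin N → Fin N → ℂ))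
  haveI : SecondCountableTopology (Matrix.specialUnitaryGroup (Fin N) ℂ) :=
    Topology.IsEmbedding.subtypeVal.secondCountableTopology
  obtain ⟨Lseq, hLmono, hμL⟩ := hμ
  haveI := hμL.1
  by_contra h
  exact Literature.Barriers.QuantumFields.not_exists_clusteringRate_of_not_hasExponentialDecay_plaquetteCorrFn
    (fundamentalRep (Fin N)) (continuous_fundamentalRep (Fin N))
    (fun U => fundamentalRep_mem_unitaryGroup U) h hm

/-- **Exponential decay of the plaquette–plaquette correlation function of every limit state, from star
windows on all large tori** (`SU(N)`, `d = 4`).  Port of `StarLimit.su2Star_hasExponentialDecay_plaquetteCorrFn`.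
[folklore] -/
theorem star_hasExponentialDecay_plaquetteCorrFn (hN : 1 ≤ N) (β : ℝ) {ρ : ℝ} (hρ0 : 0 ≤ ρ) (hρ1 : ρ < 1)
    (L₁ : ℕ)
    (hW : ∀ (L : ℕ) [NeZero L], L₁ ≤ L → ∃ Kw : Site 4 L → Edge 4 L → Edge 4 L → ℝ,
      (∀ s y e, 0 ≤ Kw s y e) ∧ (∀ s y e, Kw s y e ≠ 0 → ∀ w ∈ linkEnds y, torusNorm (s - w) ≤ 1) ∧
      IsLinkWindowContraction (d := 4) (L := L) (wilsonPlaqWeight N β) suFrobDist starWin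
        (fun c => Kw c.1) ∧
      ∀ (s : Site 4 L) (e : Edge 4 L), e ∈ vertexStar s → ∑ y, Kw s y e ≤ ρ) :
    ∀ μ ∈ infiniteVolumeLimitPoints (d := 4) (fundamentalRep (Fin N)) β,
      HasExponentialDecay (plaquetteCorrFn (fundamentalRep (Fin N)) μ) :=
  fun μ hμ => hasExponentialDecay_plaquetteCorrFn_of_isMassiveState hμ
    (star_isMassiveState hN β hρ0 hρ1 L₁ hW μ hμ)

/-! ### From ANY one-link modulus (the windows on every torus of side `≥ 3`) -/

/-- **Every limit state is massive, from a one-link modulus** (`SU(N)`, `N ≥ 1`, tree coupling `β`):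
`OneLinkKRModulus N R K` with `K ≥ 0` on the tilt ball `R ≥ 6|β|/N` and `4K|β|/N ≤ 9/25` gives the star
windows on every torus of side `≥ 3` (`StarLemmaGSUN.star_window_of_oneLinkKRModulus`, received sum
`ρ = R_G(4K|β|/N) < 1`), hence `IsMassiveState μ` for every `μ ∈ infiniteVolumeLimitPoints (fundamentalRep (Fin N)) β`,
rate `κ(ρ)`. [folklore] -/
theorem isMassiveState_of_oneLinkKRModulus (hN : 1 ≤ N) {β R K : ℝ} (hK0 : 0 ≤ K)
    (hR : |β| / N * 6 ≤ R) (hmod : OneLinkKRModulus N R K) (h : 4 * (K * (|β| / N)) ≤ 9 / 25) :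
    ∀ μ ∈ infiniteVolumeLimitPoints (d := 4) (fundamentalRep (Fin N)) β, IsMassiveState μ := by
  have hc0 : 0 ≤ K * (|β| / N) := mul_nonneg hK0 (by positivity)
  have hc6 : K * (|β| / N) < 1 / 6 := by linarith
  have hρ0 : 0 ≤ gaugeR (4 * (K * (|β| / N))) := StarLemmaG.gaugeR_nonneg (by linarith) (by linarith)
  have hρ1 : gaugeR (4 * (K * (|β| / N))) < 1 := gaugeR_lt_one_of_le (by linarith) h
  refine star_isMassiveState hN β hρ0 hρ1 3 fun L _ hL => ?_
  obtain ⟨hK, hKloc, hH1, hH2⟩ := star_window_of_oneLinkKRModulus (L := L) hL hN hK0 hR hmod hc6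
  exact ⟨_, hK, hKloc, hH1, fun s e he => (hH2 s e he).le⟩

/-- **Plaquette–plaquette decay for every limit state, from a one-link modulus** (`SU(N)`). [folklore] -/
theorem hasExponentialDecay_plaquetteCorrFn_of_oneLinkKRModulus (hN : 1 ≤ N) {β R K : ℝ} (hK0 : 0 ≤ K)
    (hR : |β| / N * 6 ≤ R) (hmod : OneLinkKRModulus N R K) (h : 4 * (K * (|β| / N)) ≤ 9 / 25) :
    ∀ μ ∈ infiniteVolumeLimitPoints (d := 4) (fundamentalRep (Fin N)) β,
      HasExponentialDecay (plaquetteCorrFn (fundamentalRep (Fin N)) μ) :=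
  fun μ hμ => hasExponentialDecay_plaquetteCorrFn_of_isMassiveState hμ
    (isMassiveState_of_oneLinkKRModulus hN hK0 hR hmod h μ hμ)

/-! ### Hypothesis-free rows for every `SU(N)`, `N ≥ 2` (Bakry–Émery modulus), two-sided -/

/-- ★ **EVERY INFINITE-VOLUME LIMIT STATE OF `SU(N)` LATTICE YANG–MILLS (`d = 4`, Wilson, EVERY `N ≥ 2`) IS
MASSIVE at every tree coupling `|β|/N ≤ 9/308 = 0.02922…`** (NO hypothesis): for every subsequential limit
`μ` of the torus Wilson states and all bounded measurable local observables `F₁, F₂` of `ℤ⁴`,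
`|cov_μ(F₁, F₂ ∘ θ_x)| ≤ C(F₁, F₂) e^{−κ ‖x‖_∞}` with one rate `κ > 0` (`IsMassiveState μ`) — the star window
with the Bakry–Émery modulus `oneLinkKRModulus_SU` (`K = 1/(1/2 − 6|β|/N)`; ds-1's arithmetic
inlined: `4K|β|/N ≤ 9/25`, equality at `9/308`).  `SU(2)` has the sharper row
`StarLimit.su2_isMassiveState_le_9_25` (Wilson `β_W ≤ 9/25` = 't Hooft `9/100`). [folklore] -/
theorem isMassiveState_SU_star (hN : 2 ≤ N) {β : ℝ} (h : |β| / N ≤ 9 / 308) :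
    ∀ μ ∈ infiniteVolumeLimitPoints (d := 4) (fundamentalRep (Fin N)) β, IsMassiveState μ := by
  -- the Bakry–Émery coefficient (ds-1's `StarSUN.bakryEmery_coef_le_abs`, inlined): `6|β|/N < 1/2`,
  -- `K = 1/(1/2 − 6|β|/N) ≥ 0`, `4K|β|/N ≤ 9/25`
  have hN0 : (0 : ℝ) < N := by exact_mod_cast (show 0 < N by omega)
  have hx0 : 0 ≤ |β| / N := div_nonneg (abs_nonneg β) hN0.le
  have h1 : |β| / N * 6 < 1 / 2 := by linarith
  have hpos : 0 < 1 / 2 - |β| / N * 6 := by linarith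
  have h4 : 4 * (1 / (1 / 2 - |β| / N * 6) * (|β| / N)) ≤ 9 / 25 := by
    rw [show 4 * (1 / (1 / 2 - |β| / N * 6) * (|β| / N)) = (4 * (|β| / N)) / (1 / 2 - |β| / N * 6) by ring,
      div_le_iff₀ hpos]
    linarith
  exact isMassiveState_of_oneLinkKRModulus (by omega) (one_div_pos.2 hpos).le le_rfl
    (oneLinkKRModulus_SU hN h1) h4

/-- ★ **EXPONENTIAL DECAY OF THE PLAQUETTE–PLAQUETTE CORRELATION FUNCTION** (NO hypothesis) in every
infinite-volume limit state of `SU(N)` lattice Yang–Mills, `d = 4`, Wilson action, EVERY `N ≥ 2`, at every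
tree coupling `|β|/N ≤ 9/308`: `plaquetteCorrFn (fundamentalRep (Fin N)) μ` (Chatterjee's `f_β`; the
operational mass-gap criterion of Montvay–Münster §3.4.5) satisfies `HasExponentialDecay`. [folklore] -/
theorem hasExponentialDecay_plaquetteCorrFn_SU_star (hN : 2 ≤ N) {β : ℝ} (h : |β| / N ≤ 9 / 308) :
    ∀ μ ∈ infiniteVolumeLimitPoints (d := 4) (fundamentalRep (Fin N)) β,
      HasExponentialDecay (plaquetteCorrFn (fundamentalRep (Fin N)) μ) :=
  fun μ hμ => hasExponentialDecay_plaquetteCorrFn_of_isMassiveState hμ (isMassiveState_SU_star hN h μ hμ)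

end Summit.Ventures.YMGap.StarSUNMassive

end
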